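import Summits.CriticalPhenomena.PercolationContinuityZ3.Theorems.PercNearOneGluingNoHeavyLowerTailThreePointProductFormFibreCutVertex
import HarnessLib

/-!
# Parallel composition at the three terminals, I: walks split at the terminal set; the flat is decided side by side
# (Sahi programme, prover prim-sahi-p2 gen 59)

Support file (`--supports stmt-CriticalPhenomena-4575`, helper).  Standard axioms, no sorries, no named facts, no definitions.
Memo `run/shared/lean/prim/prim-sahi/FROM-prim-sahi-p2-gen59-ONE-STEP-LEMMA.md` §3, §8(2); `prim-sahi-p2/PROOF-E3.md` (63k), §69.

SETTING.  Terminals `s, a, c` of a finite multigraph `(V, α, ends)`; a SIDE is a vertex predicate `P` (terminal-free) with a label predicate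
`Q` such that every OPEN label at a `P`-vertex is a `Q`-label and every `Q`-label has its endpoints in `P ∪ {s,a,c}`; `w` is any
configuration open on the open `Q`-labels (typically the restriction `fun l => z l && decide (Q l)`).  Two sides `(P₁,Q₁,w₁)`, `(P₂,Q₂,w₂)`
with every open label in `Q₁ ∪ Q₂` present `z` as a PARALLEL COMPOSITION at `{s,a,c}` (other labels closed).
* `exists_terminal_of_walk` — an open walk from a `P`-vertex to a terminal reaches some terminal by a `w`-open path first.
* `exists_side_reachable_of_walk` — an open walk between distinct terminals joins its start to SOME other terminal on one side.
* `isolated_iff_sides` — a terminal is isolated from the other two iff it is so in `w₁` and in `w₂` (given `wᵢ ≤ z`).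
* `reachable_side_of_reachable` — if `a` is isolated from `s, c`, a `P`-vertex in the open cluster of `a` is joined to `a` inside `w`.
* `flat_eq_of_side` — hence the flat `♭z = clusterFlip ends a z̄` agrees on the `Q`-labels with the flat of `w` whenever `w` agrees with `z` on `Q`.
These are the walk-level facts behind the multiplicativity of the six fibre statistics `#S0, #(S0∪P1), #(S0∪P2), Ga, Gb, G1` under
parallel composition (gen 53 (63k) 'zeta coordinates'; gen 59 §3), proved in the companion file.
[this work] (gen 59); [folklore] (walk surgery).
-/

namespace Summit.CriticalPhenomena.PercolationContinuityZ3.Theorems.ProductFormFibre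

open Finset Literature.Probability.Percolation
open Summit.CriticalPhenomena.PercolationContinuityZ3.Theorems.ThreePointCPIClusterSwap
  (QTouch clusterFlip clusterFlip_of_qtouch clusterFlip_of_not_qtouch)

variable {V α : Type*}

section Split

variable (ends : α → Sym2 V) (s a c : V)

/-- **First terminal on one side.**  An open `z`-walk from a `P`-vertex `x` to a terminal reaches some terminal `t` from `x` by a
`w`-open path, the rest of the walk being no longer than the walk. [this work] -/
theorem exists_terminal_of_walk (P : V → Prop) (Q : α → Prop) (z w : α → Bool)
    (hPQ : ∀ l, z l = true → ∀ x ∈ ends l, P x → Q l)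
    (hQP : ∀ l, Q l → ∀ v ∈ ends l, P v ∨ (v = s ∨ v = a ∨ v = c))
    (hPT : ∀ v, P v → ¬ (v = s ∨ v = a ∨ v = c))
    (hw : ∀ l, Q l → z l = true → w l = true) :
    ∀ {x y : V} (p : (openGraph (labelledOpen ends z)).Walk x y), P x → (y = s ∨ y = a ∨ y = c) →
      ∃ t, (t = s ∨ t = a ∨ t = c) ∧ (openGraph (labelledOpen ends w)).Reachable x t ∧
        ∃ q : (openGraph (labelledOpen ends z)).Walk t y, q.length ≤ p.length
  | x, _, .nil, hx, hy => absurd hy (hPT x hx)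
  | x, y, .cons (v := v) h p, hx, hy => by
      have h' := h
      rw [openGraph_adj] at h'
      obtain ⟨⟨l, hl, hlv⟩, hne⟩ := h'
      have hQ : Q l := hPQ l hl x (by rw [hlv]; exact Sym2.mem_mk_left x v) hx
      have hxv : (openGraph (labelledOpen ends w)).Reachable x v := by
        refine SimpleGraph.Adj.reachable ?_
        rw [openGraph_adj]
        exact ⟨⟨l, hw l hQ hl, hlv⟩, hne⟩
      rcases hQP l hQ v (by rw [hlv]; exact Sym2.mem_mk_right x v) with hv | hv
      · obtain ⟨t, ht, hr, q, hq⟩ := exists_terminal_of_walk P Q z w hPQ hQP hPT hw p hv hy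
        refine ⟨t, ht, hxv.trans hr, q, ?_⟩
        rw [SimpleGraph.Walk.length_cons]; omega
      · refine ⟨v, hv, hxv, p, ?_⟩
        rw [SimpleGraph.Walk.length_cons]; omega

/-- **Walk splitting at the terminal set.**  With two sides covering the open labels, an open `z`-walk from a terminal `t₁` to a
different terminal yields a terminal `t ≠ t₁` joined to `t₁` by a `w₁`-open or a `w₂`-open path. [this work] -/
theorem exists_side_reachable_of_walk (P₁ P₂ : V → Prop) (Q₁ Q₂ : α → Prop) (z w₁ w₂ : α → Bool)
    (hPQ₁ : ∀ l, z l = true → ∀ x ∈ ends l, P₁ x → Q₁ l) (hQP₁ : ∀ l, Q₁ l → ∀ v ∈ ends l, P₁ v ∨ (v = s ∨ v = a ∨ v = c))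
    (hPT₁ : ∀ v, P₁ v → ¬ (v = s ∨ v = a ∨ v = c))
    (hPQ₂ : ∀ l, z l = true → ∀ x ∈ ends l, P₂ x → Q₂ l) (hQP₂ : ∀ l, Q₂ l → ∀ v ∈ ends l, P₂ v ∨ (v = s ∨ v = a ∨ v = c))
    (hPT₂ : ∀ v, P₂ v → ¬ (v = s ∨ v = a ∨ v = c))
    (hcoverL : ∀ l, z l = true → Q₁ l ∨ Q₂ l)
    (hw₁ : ∀ l, Q₁ l → z l = true → w₁ l = true) (hw₂ : ∀ l, Q₂ l → z l = true → w₂ l = true) :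
    ∀ (n : ℕ) {t₁ y : V} (p : (openGraph (labelledOpen ends z)).Walk t₁ y), p.length ≤ n →
      (t₁ = s ∨ t₁ = a ∨ t₁ = c) → (y = s ∨ y = a ∨ y = c) → y ≠ t₁ →
      ∃ t, (t = s ∨ t = a ∨ t = c) ∧ t ≠ t₁ ∧
        ((openGraph (labelledOpen ends w₁)).Reachable t₁ t ∨ (openGraph (labelledOpen ends w₂)).Reachable t₁ t) := by
  intro n
  induction n with
  | zero =>
    intro t₁ y p hp _ _ hne
    have : p.length = 0 := Nat.le_zero.mp hp
    have := SimpleGraph.Walk.eq_of_length_eq_zero this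
    exact absurd this.symm hne
  | succ n ih =>
    intro t₁ y p hp ht₁ hy hne
    cases p with
    | nil => exact absurd rfl hne
    | cons h p =>
      rename_i v
      have h' := h
      rw [openGraph_adj] at h'
      obtain ⟨⟨l, hl, hlv⟩, hne'⟩ := h'
      have hlen : p.length ≤ n := by rw [SimpleGraph.Walk.length_cons] at hp; omega
      have hvl : v ∈ ends l := by rw [hlv]; exact Sym2.mem_mk_right t₁ v
      rcases hcoverL l hl with hQ | hQ
      · have h1 : (openGraph (labelledOpen ends w₁)).Reachable t₁ v := by
          refine SimpleGraph.Adj.reachable ?_; rw [openGraph_adj]; exact ⟨⟨l, hw₁ l hQ hl, hlv⟩, hne'⟩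
        rcases hQP₁ l hQ v hvl with hv | hv
        · obtain ⟨t, ht, hr, q, hq⟩ := exists_terminal_of_walk ends s a c P₁ Q₁ z w₁ hPQ₁ hQP₁ hPT₁ hw₁ p hv hy
          by_cases htt : t = t₁
          · subst htt
            exact ih q (hq.trans hlen) ht₁ hy hne
          · exact ⟨t, ht, htt, Or.inl (h1.trans hr)⟩
        · by_cases hvt : v = t₁
          · subst hvt
            exact ih p hlen ht₁ hy hne
          · exact ⟨v, hv, hvt, Or.inl h1⟩
      · have h2 : (openGraph (labelledOpen ends w₂)).Reachable t₁ v := by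
          refine SimpleGraph.Adj.reachable ?_; rw [openGraph_adj]; exact ⟨⟨l, hw₂ l hQ hl, hlv⟩, hne'⟩
        rcases hQP₂ l hQ v hvl with hv | hv
        · obtain ⟨t, ht, hr, q, hq⟩ := exists_terminal_of_walk ends s a c P₂ Q₂ z w₂ hPQ₂ hQP₂ hPT₂ hw₂ p hv hy
          by_cases htt : t = t₁
          · subst htt
            exact ih q (hq.trans hlen) ht₁ hy hne
          · exact ⟨t, ht, htt, Or.inr (h2.trans hr)⟩
        · by_cases hvt : v = t₁
          · subst hvt
            exact ih p hlen ht₁ hy hne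
          · exact ⟨v, hv, hvt, Or.inr h2⟩

/-- **A terminal is isolated from the other two terminals iff it is so on each side** (`wᵢ ≤ z` on open labels). [this work] -/
theorem isolated_iff_sides (P₁ P₂ : V → Prop) (Q₁ Q₂ : α → Prop) (z w₁ w₂ : α → Bool)
    (hPQ₁ : ∀ l, z l = true → ∀ x ∈ ends l, P₁ x → Q₁ l) (hQP₁ : ∀ l, Q₁ l → ∀ v ∈ ends l, P₁ v ∨ (v = s ∨ v = a ∨ v = c))
    (hPT₁ : ∀ v, P₁ v → ¬ (v = s ∨ v = a ∨ v = c))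
    (hPQ₂ : ∀ l, z l = true → ∀ x ∈ ends l, P₂ x → Q₂ l) (hQP₂ : ∀ l, Q₂ l → ∀ v ∈ ends l, P₂ v ∨ (v = s ∨ v = a ∨ v = c))
    (hPT₂ : ∀ v, P₂ v → ¬ (v = s ∨ v = a ∨ v = c))
    (hcoverL : ∀ l, z l = true → Q₁ l ∨ Q₂ l)
    (hw₁ : ∀ l, Q₁ l → z l = true → w₁ l = true) (hw₂ : ∀ l, Q₂ l → z l = true → w₂ l = true)
    (hw₁' : ∀ l, w₁ l = true → z l = true) (hw₂' : ∀ l, w₂ l = true → z l = true)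
    {t₁ t₂ t₃ : V} (ht₁ : t₁ = s ∨ t₁ = a ∨ t₁ = c) (ht₂ : t₂ = s ∨ t₂ = a ∨ t₂ = c) (ht₃ : t₃ = s ∨ t₃ = a ∨ t₃ = c)
    (hT : ∀ t, (t = s ∨ t = a ∨ t = c) → t ≠ t₁ → t = t₂ ∨ t = t₃) :
    (¬ (openGraph (labelledOpen ends z)).Reachable t₁ t₂ ∧ ¬ (openGraph (labelledOpen ends z)).Reachable t₁ t₃) ↔
    ((¬ (openGraph (labelledOpen ends w₁)).Reachable t₁ t₂ ∧ ¬ (openGraph (labelledOpen ends w₁)).Reachable t₁ t₃) ∧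
     (¬ (openGraph (labelledOpen ends w₂)).Reachable t₁ t₂ ∧ ¬ (openGraph (labelledOpen ends w₂)).Reachable t₁ t₃)) := by
  have mono : ∀ (w : α → Bool), (∀ l, w l = true → z l = true) → ∀ {x y : V},
      (openGraph (labelledOpen ends w)).Reachable x y → (openGraph (labelledOpen ends z)).Reachable x y := by
    intro w hwz x y h
    obtain ⟨p⟩ := h
    exact reachable_of_walk_of_labels ends w z p fun l hl _ => hwz l hl
  constructor
  · rintro ⟨h₂, h₃⟩
    exact ⟨⟨fun h => h₂ (mono w₁ hw₁' h), fun h => h₃ (mono w₁ hw₁' h)⟩,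
      ⟨fun h => h₂ (mono w₂ hw₂' h), fun h => h₃ (mono w₂ hw₂' h)⟩⟩
  · rintro ⟨⟨h₁₂, h₁₃⟩, ⟨h₂₂, h₂₃⟩⟩
    have key : ∀ {y : V}, (y = s ∨ y = a ∨ y = c) → y ≠ t₁ → ¬ (openGraph (labelledOpen ends z)).Reachable t₁ y := by
      intro y hy hne h
      obtain ⟨p⟩ := h
      obtain ⟨t, ht, htne, hr⟩ := exists_side_reachable_of_walk ends s a c P₁ P₂ Q₁ Q₂ z w₁ w₂ hPQ₁ hQP₁ hPT₁ hPQ₂ hQP₂ hPT₂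
        hcoverL hw₁ hw₂ p.length p le_rfl ht₁ hy hne
      rcases hT t ht htne with rfl | rfl
      · rcases hr with hr | hr
        · exact h₁₂ hr
        · exact h₂₂ hr
      · rcases hr with hr | hr
        · exact h₁₃ hr
        · exact h₂₃ hr
    have e2 : t₂ ≠ t₁ := by rintro rfl; exact h₁₂ (SimpleGraph.Reachable.refl _)
    have e3 : t₃ ≠ t₁ := by rintro rfl; exact h₁₃ (SimpleGraph.Reachable.refl _)
    exact ⟨key ht₂ e2, key ht₃ e3⟩

/-- **The apex cluster is decided on its own side.**  If `a` is isolated from `s` and `c` in `z`, a `P`-vertex joined to `a` in `z` is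
joined to `a` by a `w`-open path. [this work] -/
theorem reachable_side_of_reachable (P : V → Prop) (Q : α → Prop) (z w : α → Bool)
    (hPQ : ∀ l, z l = true → ∀ x ∈ ends l, P x → Q l)
    (hQP : ∀ l, Q l → ∀ v ∈ ends l, P v ∨ (v = s ∨ v = a ∨ v = c))
    (hPT : ∀ v, P v → ¬ (v = s ∨ v = a ∨ v = c))
    (hw : ∀ l, Q l → z l = true → w l = true)
    (has : ¬ (openGraph (labelledOpen ends z)).Reachable a s) (hac : ¬ (openGraph (labelledOpen ends z)).Reachable a c)
    {x : V} (hx : P x) (h : (openGraph (labelledOpen ends z)).Reachable a x) :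
    (openGraph (labelledOpen ends w)).Reachable a x := by
  obtain ⟨p⟩ := h
  obtain ⟨t, ht, hr, q, -⟩ := exists_terminal_of_walk ends s a c P Q z w hPQ hQP hPT hw p.reverse hx (Or.inr (Or.inl rfl))
  have hta : (openGraph (labelledOpen ends z)).Reachable a t := ⟨q.reverse⟩
  rcases ht with rfl | rfl | rfl
  · exact absurd hta has
  · exact hr.symm
  · exact absurd hta hac

/-- **Touching the apex cluster is decided on the label's own side** (for `a` isolated from `s, c`). [this work] -/
theorem qtouch_iff_of_side [DecidableEq V] (P : V → Prop) (Q : α → Prop) (z w : α → Bool)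
    (hPQ : ∀ l, z l = true → ∀ x ∈ ends l, P x → Q l)
    (hQP : ∀ l, Q l → ∀ v ∈ ends l, P v ∨ (v = s ∨ v = a ∨ v = c))
    (hPT : ∀ v, P v → ¬ (v = s ∨ v = a ∨ v = c))
    (hw : ∀ l, Q l → z l = true → w l = true) (hw' : ∀ l, w l = true → z l = true)
    (has : ¬ (openGraph (labelledOpen ends z)).Reachable a s) (hac : ¬ (openGraph (labelledOpen ends z)).Reachable a c)
    {l : α} (hl : Q l) :
    QTouch ends a (fun x => !z x) l ↔ QTouch ends a (fun x => !w x) l := by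
  rw [qtouch_compl_iff, qtouch_compl_iff]
  constructor
  · rintro ⟨v, hv, hr⟩
    refine ⟨v, hv, ?_⟩
    rcases hQP l hl v hv with hP | hT
    · exact reachable_side_of_reachable ends s a c P Q z w hPQ hQP hPT hw has hac hP hr
    · rcases hT with rfl | rfl | rfl
      · exact absurd hr has
      · exact SimpleGraph.Reachable.refl _
      · exact absurd hr hac
  · rintro ⟨v, hv, hr⟩
    obtain ⟨p⟩ := hr
    exact ⟨v, hv, reachable_of_walk_of_labels ends w z p fun l' hl' _ => hw' l' hl'⟩

/-- **The flat agrees, on a side's labels, with the flat of the side** (`a` isolated from `s, c`; `w = z` on `Q`). [this work] -/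
theorem flat_eq_of_side [DecidableEq V] (P : V → Prop) (Q : α → Prop) (z w : α → Bool)
    (hPQ : ∀ l, z l = true → ∀ x ∈ ends l, P x → Q l)
    (hQP : ∀ l, Q l → ∀ v ∈ ends l, P v ∨ (v = s ∨ v = a ∨ v = c))
    (hPT : ∀ v, P v → ¬ (v = s ∨ v = a ∨ v = c))
    (hw : ∀ l, Q l → z l = true → w l = true) (hw' : ∀ l, w l = true → z l = true) (hwQ : ∀ l, Q l → w l = z l)
    (has : ¬ (openGraph (labelledOpen ends z)).Reachable a s) (hac : ¬ (openGraph (labelledOpen ends z)).Reachable a c)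
    {l : α} (hl : Q l) :
    clusterFlip ends a (fun x => !z x) l = clusterFlip ends a (fun x => !w x) l := by
  classical
  have hq := qtouch_iff_of_side ends s a c P Q z w hPQ hQP hPT hw hw' has hac hl
  by_cases h : QTouch ends a (fun x => !z x) l
  · rw [clusterFlip_of_qtouch ends a _ h, clusterFlip_of_qtouch ends a _ (hq.1 h), hwQ l hl]
  · rw [clusterFlip_of_not_qtouch ends a _ h, clusterFlip_of_not_qtouch ends a _ (fun h' => h (hq.2 h')), hwQ l hl]

end Split

end Summit.CriticalPhenomena.PercolationContinuityZ3.Theorems.ProductFormFibre
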